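import Literature.NumberTheory.DiophantineApproximation.GeneralizedPolynomialsProofs

/-!
# Kuipers–Niederreiter's Theorem 1.1 along arbitrary averaging schemes; the bracket `c{p(n)} + d` case of Bergelson–Leibman Cor. 0.26

Companion of `GeneralizedPolynomialsProofs.lean` (Weyl along Følner sequences of `ℤ`). Everything
here is PROVED; no named fact is introduced.

* `tendsto_savg_of_counting` — **Kuipers–Niederreiter, Ch. 1, Thm. 1.1, for an arbitrary averaging
  scheme** `S : ℕ → Finset X`, `v : X → [0, 1)`: if the proportion of `x ∈ S_N` with
  `v(x) ∈ [a, b)` tends to `b - a` for all `0 ≤ a < b ≤ 1`, then `|S_N|⁻¹ Σ_{x ∈ S_N} f(v(x)) → ∫₀¹ f`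
  for every `f` continuous on `[0, 1]` (K–N's step-function sandwich, verbatim; the tree's
  `UniformDistribution.EquidistributedModOne.tendsto_fractAvg` is the scheme `S_N = {0,…,N-1}`);
  complex version `tendsto_savg_complex_of_counting` (Cor. 1.2).
* `IsFoelnerSeq.tendsto_avg_comp_fract_poly` — with `weyl_tendsto_card_fract_mem_Ico`: for `p ∈ ℝ[X]`
  with an irrational coefficient of positive degree and `f` continuous on `[0,1]`,
  `|Φ_N|⁻¹ Σ_{n ∈ Φ_N} f({p(n)}) → ∫₀¹ f` along every Følner sequence `Φ` of `ℤ`.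
* `FoelnerWeyl.exists_period_of_rational_coeffs` — if all coefficients of positive degree are
  rational, `p(n + q) - p(n) ∈ ℤ` for a suitable `q ≥ 1`, so `{p(n)}` is `q`-periodic.
* `bergelsonLeibman2007_cor_0_26_const_mul_fract_poly` — the inner statement of the fact
  `BergelsonLeibman2007_cor_0_26` for the generalized polynomials `u(n) = c·{p(n)} + d` (one bracket
  of a polynomial; constructors `add/mul/const/fract/poly`), unconditionally: the limit of
  `|Φ_N|⁻¹ Σ e(u(n))` exists and does not depend on the Følner sequence.
* consumer API of the fact: `BergelsonLeibman2007_cor_0_26.exists_tendsto_avg_range` (limits of the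
  standard averages `N⁻¹ Σ_{n<N}`), `IsGeneralizedPolynomial.const_mul`.

## References

* [KuipersNiederreiter1974] L. Kuipers, H. Niederreiter, *Uniform distribution of sequences*, Wiley
  1974, Ch. 1, Thm. 1.1, Cor. 1.2 (proof followed verbatim, for a general averaging scheme).
* [Weyl1916] H. Weyl, Math. Ann. 77 (1916), Satz 9, 12.
* [BergelsonLeibman2007] V. Bergelson, A. Leibman, Acta Math. 198 (2007), Cor. 0.26.
-/

noncomputable section

open Filter Finset Polynomial MeasureTheory
open scoped Topology

namespace Literature.NumberTheory.DiophantineApproximation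

/-! ### Averages along a finite scheme -/

namespace FoelnerWeyl

variable {X : Type*}

/-- Monotonicity of scheme averages in the test function (values of `v` in `[0,1)`). [folklore] -/
theorem savg_mono (A : Finset X) {v : X → ℝ} (hv : ∀ x, v x ∈ Set.Ico (0 : ℝ) 1) {g₁ g₂ : ℝ → ℝ}
    (h : ∀ y ∈ Set.Ico (0 : ℝ) 1, g₁ y ≤ g₂ y) :
    (∑ x ∈ A, g₁ (v x)) / A.card ≤ (∑ x ∈ A, g₂ (v x)) / A.card :=
  div_le_div_of_nonneg_right (Finset.sum_le_sum fun x _ => h _ (hv x)) (Nat.cast_nonneg _)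

/-- Additivity. [folklore] -/
theorem savg_add (A : Finset X) (v : X → ℝ) (g₁ g₂ : ℝ → ℝ) :
    (∑ x ∈ A, (g₁ (v x) + g₂ (v x))) / A.card =
      (∑ x ∈ A, g₁ (v x)) / A.card + (∑ x ∈ A, g₂ (v x)) / A.card := by
  rw [Finset.sum_add_distrib, add_div]

/-- Subtractivity. [folklore] -/
theorem savg_sub (A : Finset X) (v : X → ℝ) (g₁ g₂ : ℝ → ℝ) :
    (∑ x ∈ A, (g₁ (v x) - g₂ (v x))) / A.card =
      (∑ x ∈ A, g₁ (v x)) / A.card - (∑ x ∈ A, g₂ (v x)) / A.card := by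
  rw [Finset.sum_sub_distrib, sub_div]

/-- Homogeneity. [folklore] -/
theorem savg_const_mul (A : Finset X) (v : X → ℝ) (c : ℝ) (g : ℝ → ℝ) :
    (∑ x ∈ A, c * g (v x)) / A.card = c * ((∑ x ∈ A, g (v x)) / A.card) := by
  rw [← Finset.mul_sum, mul_div_assoc]

/-- Finite sums of test functions. [folklore] -/
theorem savg_finset_sum (A : Finset X) (v : X → ℝ) {ι : Type*} (s : Finset ι) (g : ι → ℝ → ℝ) :
    (∑ x ∈ A, ∑ i ∈ s, g i (v x)) / A.card = ∑ i ∈ s, (∑ x ∈ A, g i (v x)) / A.card := by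
  rw [Finset.sum_comm, Finset.sum_div]

/-- The average of a constant. [folklore] -/
theorem savg_const (A : Finset X) (hA : A.card ≠ 0) (c : ℝ) : (∑ _x ∈ A, c) / A.card = c := by
  have : (A.card : ℝ) ≠ 0 := Nat.cast_ne_zero.2 hA
  rw [Finset.sum_const, nsmul_eq_mul]
  field_simp

/-- The average of the indicator of `[a, b)` is the counting frequency. [folklore] -/
theorem savg_indicator [DecidableEq X] (A : Finset X) (v : X → ℝ) (a b : ℝ) :
    (∑ x ∈ A, Set.indicator (Set.Ico a b) (1 : ℝ → ℝ) (v x)) / A.card =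
      ((A.filter fun x => v x ∈ Set.Ico a b).card : ℝ) / A.card := by
  classical
  rw [Finset.natCast_card_filter]
  congr 1
  refine Finset.sum_congr rfl fun x _ => ?_
  by_cases h : v x ∈ Set.Ico a b <;> simp [h]

end FoelnerWeyl

open FoelnerWeyl

section Scheme

variable {X : Type*}

/-- **Sandwich lemma for scheme averages** (the mechanism of K–N Cor. 1.1). [folklore] -/
theorem tendsto_savg_squeeze (S : ℕ → Finset X) {v : X → ℝ} (hv : ∀ x, v x ∈ Set.Ico (0 : ℝ) 1)
    {f : ℝ → ℝ} {L : ℝ}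
    (h : ∀ ε > 0, ∃ (g₁ g₂ : ℝ → ℝ) (L₁ L₂ : ℝ),
      (∀ y ∈ Set.Ico (0 : ℝ) 1, g₁ y ≤ f y) ∧ (∀ y ∈ Set.Ico (0 : ℝ) 1, f y ≤ g₂ y) ∧
      Tendsto (fun N => (∑ x ∈ S N, g₁ (v x)) / (S N).card) atTop (𝓝 L₁) ∧
      Tendsto (fun N => (∑ x ∈ S N, g₂ (v x)) / (S N).card) atTop (𝓝 L₂) ∧
      L - ε ≤ L₁ ∧ L₂ ≤ L + ε) :
    Tendsto (fun N => (∑ x ∈ S N, f (v x)) / (S N).card) atTop (𝓝 L) := by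
  refine tendsto_order.2 ⟨fun c hc => ?_, fun c hc => ?_⟩
  · obtain ⟨g₁, g₂, L₁, L₂, hg₁, -, h₁, -, hL₁, -⟩ := h ((L - c) / 2) (by linarith)
    have hc' : c < L₁ := by linarith
    filter_upwards [(tendsto_order.1 h₁).1 c hc'] with N hN
    exact hN.trans_le (savg_mono (S N) hv hg₁)
  · obtain ⟨g₁, g₂, L₁, L₂, -, hg₂, -, h₂, -, hL₂⟩ := h ((c - L) / 2) (by linarith)
    have hc' : L₂ < c := by linarith
    filter_upwards [(tendsto_order.1 h₂).2 c hc'] with N hN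
    exact (savg_mono (S N) hv hg₂).trans_lt hN

/-- **Kuipers–Niederreiter, Ch. 1, Thm. 1.1, for an arbitrary averaging scheme.** Let `S_N` be
finite sets (eventually non-empty) and `v : X → [0, 1)`. If for all `0 ≤ a < b ≤ 1` the proportion of
`x ∈ S_N` with `v(x) ∈ [a, b)` tends to `b - a`, then `|S_N|⁻¹ Σ_{x ∈ S_N} f(v(x)) → ∫₀¹ f` for every
real `f` continuous on `[0, 1]` (K–N's proof: squeeze `f` within `ε` by the step function
`Σ_{j<K} f(j/K) 𝟙[j/K,(j+1)/K)`). [cite: KuipersNiederreiter1974, Ch. 1, Theorem 1.1] -/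
theorem tendsto_savg_of_counting [DecidableEq X] (S : ℕ → Finset X) {v : X → ℝ}
    (hv : ∀ x, v x ∈ Set.Ico (0 : ℝ) 1) (hS : ∀ᶠ N in atTop, (S N).card ≠ 0)
    (hcount : ∀ a b : ℝ, 0 ≤ a → a < b → b ≤ 1 →
      Tendsto (fun N => (((S N).filter fun x => v x ∈ Set.Ico a b).card : ℝ) / (S N).card)
        atTop (𝓝 (b - a)))
    {f : ℝ → ℝ} (hf : ContinuousOn f (Set.Icc 0 1)) :
    Tendsto (fun N => (∑ x ∈ S N, f (v x)) / (S N).card) atTop (𝓝 (∫ x in (0 : ℝ)..1, f x)) := by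
  refine tendsto_savg_squeeze S hv fun ε hε => ?_
  have hε2 : 0 < ε / 2 := half_pos hε
  obtain ⟨δ, hδ, hUC⟩ := Metric.uniformContinuousOn_iff_le.1
    (isCompact_Icc.uniformContinuousOn_of_continuous hf) (ε / 2) hε2
  obtain ⟨K₀, hK₀⟩ := exists_nat_one_div_lt hδ
  set K : ℕ := K₀ + 1 with hKdef
  have hK : 0 < K := Nat.succ_pos _
  have hKr : (0 : ℝ) < K := Nat.cast_pos.2 hK
  have hKδ : 1 / (K : ℝ) < δ := by simpa [hKdef] using hK₀
  set c : ℕ → ℝ := fun j => f (j / K) with hc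
  set step : ℝ → ℝ := fun x =>
    ∑ j ∈ Finset.range K, c j * Set.indicator (Set.Ico ((j : ℝ) / K) ((j + 1) / K)) 1 x with hstep
  have hstep_eq : ∀ x ∈ Set.Ico (0 : ℝ) 1, step x = c ⌊(K : ℝ) * x⌋₊ := by
    intro x hx
    have hj₀ : ⌊(K : ℝ) * x⌋₊ ∈ Finset.range K := by
      rw [Finset.mem_range, Nat.floor_lt (mul_nonneg hKr.le hx.1)]
      calc (K : ℝ) * x < K * 1 := mul_lt_mul_of_pos_left hx.2 hKr
        _ = K := mul_one _
    rw [hstep]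
    dsimp only
    rw [Finset.sum_eq_single_of_mem _ hj₀]
    · rw [Set.indicator_of_mem ((UniformDistribution.mem_Ico_div_iff hK hx.1 _).2 rfl),
        Pi.one_apply, mul_one]
    · intro j _ hne
      rw [Set.indicator_of_notMem, mul_zero]
      exact fun hmem => hne ((UniformDistribution.mem_Ico_div_iff hK hx.1 _).1 hmem).symm
  have hclose : ∀ x ∈ Set.Ico (0 : ℝ) 1, |f x - step x| ≤ ε / 2 := by
    intro x hx
    rw [hstep_eq x hx, hc]
    dsimp only
    have h1 : ((⌊(K : ℝ) * x⌋₊ : ℝ)) / K ≤ x := by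
      rw [div_le_iff₀ hKr, mul_comm x]
      exact Nat.floor_le (mul_nonneg hKr.le hx.1)
    have h2 : x < ((⌊(K : ℝ) * x⌋₊ : ℝ) + 1) / K := by
      rw [lt_div_iff₀ hKr, mul_comm x]
      exact Nat.lt_floor_add_one _
    have hdist : dist x (((⌊(K : ℝ) * x⌋₊ : ℝ)) / K) ≤ δ := by
      rw [Real.dist_eq, abs_of_nonneg (by linarith)]
      have : ((⌊(K : ℝ) * x⌋₊ : ℝ) + 1) / K = (⌊(K : ℝ) * x⌋₊ : ℝ) / K + 1 / K := by ring
      linarith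
    have hxI : x ∈ Set.Icc (0 : ℝ) 1 := ⟨hx.1, hx.2.le⟩
    have hyI : ((⌊(K : ℝ) * x⌋₊ : ℝ)) / K ∈ Set.Icc (0 : ℝ) 1 :=
      ⟨by positivity, h1.trans hx.2.le⟩
    have := hUC x hxI _ hyI hdist
    rwa [Real.dist_eq] at this
  set T : ℝ := ∑ j ∈ Finset.range K, c j * (1 / K) with hT
  have havg : Tendsto (fun N => (∑ x ∈ S N, step (v x)) / (S N).card) atTop (𝓝 T) := by
    have hrw : ∀ N, (∑ x ∈ S N, step (v x)) / (S N).card =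
        ∑ j ∈ Finset.range K, c j *
          ((((S N).filter fun x => v x ∈ Set.Ico ((j : ℝ) / K) ((j + 1) / K)).card : ℝ) /
            (S N).card) := by
      intro N
      rw [hstep]
      dsimp only
      rw [Finset.sum_comm, Finset.sum_div]
      refine Finset.sum_congr rfl fun j _ => ?_
      rw [← Finset.mul_sum, mul_div_assoc, savg_indicator]
    simp_rw [hrw]
    refine tendsto_finsetSum _ fun j hj => Tendsto.const_mul (c j) ?_
    have hjK : j + 1 ≤ K := Finset.mem_range.1 hj
    have h := hcount (j / K) ((j + 1) / K) (by positivity)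
      (div_lt_div_of_pos_right (lt_add_one _) hKr)
      ((div_le_one hKr).2 (by exact_mod_cast hjK))
    rwa [show ((j : ℝ) + 1) / K - j / K = 1 / K by ring] at h
  have hint : |T - ∫ x in (0 : ℝ)..1, f x| ≤ ε / 2 := by
    have hfi : ∀ k < K, IntervalIntegrable f volume ((k : ℝ) / K) ((k + 1 : ℕ) / K) := by
      intro k hk
      refine (hf.mono ?_).intervalIntegrable_of_Icc
        (div_le_div_of_nonneg_right (by exact_mod_cast (Nat.le_succ k)) hKr.le)
      refine Set.Icc_subset_Icc (by positivity) ((div_le_one hKr).2 ?_)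
      exact_mod_cast Nat.succ_le_of_lt hk
    have hsplit := intervalIntegral.sum_integral_adjacent_intervals hfi
    simp only [Nat.cast_zero, zero_div, div_self hKr.ne'] at hsplit
    rw [← hsplit, hT, ← Finset.sum_sub_distrib]
    have hterm : ∀ j ∈ Finset.range K,
        |c j * (1 / K) - ∫ x in ((j : ℝ) / K)..((j + 1 : ℕ) / K), f x| ≤ ε / 2 * (1 / K) := by
      intro j hj
      have hjK : j + 1 ≤ K := Finset.mem_range.1 hj
      have hle : (j : ℝ) / K ≤ (j + 1 : ℕ) / K :=
        div_le_div_of_nonneg_right (by exact_mod_cast (Nat.le_succ j)) hKr.le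
      have hcint : c j * (1 / K) = ∫ _ in ((j : ℝ) / K)..((j + 1 : ℕ) / K), c j := by
        rw [intervalIntegral.integral_const, smul_eq_mul]
        push_cast
        ring
      rw [hcint, ← intervalIntegral.integral_sub intervalIntegrable_const (hfi j hjK)]
      have hb := intervalIntegral.norm_integral_le_of_norm_le_const (a := (j : ℝ) / K)
        (b := ((j + 1 : ℕ) : ℝ) / K) (f := fun x => c j - f x) (C := ε / 2) ?_
      · rw [Real.norm_eq_abs] at hb
        refine hb.trans (le_of_eq ?_)
        rw [abs_of_nonneg (by linarith)]
        push_cast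
        ring
      · intro x hx
        rw [Set.uIoc_of_le hle] at hx
        push_cast at hx
        have hx0 : 0 ≤ x := le_trans (by positivity) hx.1.le
        have hx1 : x ≤ 1 := hx.2.trans ((div_le_one hKr).2 (by exact_mod_cast hjK))
        have hdist : dist ((j : ℝ) / K) x ≤ δ := by
          rw [Real.dist_eq, abs_of_nonpos (by linarith [hx.1])]
          have : ((j : ℝ) + 1) / K = (j : ℝ) / K + 1 / K := by ring
          linarith [hx.2]
        have hyI : (j : ℝ) / K ∈ Set.Icc (0 : ℝ) 1 :=
          ⟨by positivity, hx.1.le.trans hx1⟩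
        have := hUC _ hyI x ⟨hx0, hx1⟩ hdist
        rwa [Real.dist_eq, Real.norm_eq_abs] at *
    calc |∑ j ∈ Finset.range K, (c j * (1 / K) - ∫ x in ((j : ℝ) / K)..((j + 1 : ℕ) / K), f x)|
        ≤ ∑ j ∈ Finset.range K, |c j * (1 / K) - ∫ x in ((j : ℝ) / K)..((j + 1 : ℕ) / K), f x| :=
          Finset.abs_sum_le_sum_abs _ _
      _ ≤ ∑ _j ∈ Finset.range K, ε / 2 * (1 / K) := Finset.sum_le_sum hterm
      _ = ε / 2 := by
          rw [Finset.sum_const, Finset.card_range, nsmul_eq_mul]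
          field_simp
  refine ⟨fun x => step x - ε / 2, fun x => step x + ε / 2, T - ε / 2, T + ε / 2,
    fun x hx => ?_, fun x hx => ?_, ?_, ?_, ?_, ?_⟩
  · have := hclose x hx; rw [abs_le] at this; linarith
  · have := hclose x hx; rw [abs_le] at this; linarith
  · refine (havg.sub_const (ε / 2)).congr' ?_
    filter_upwards [hS] with N hN
    rw [Finset.sum_sub_distrib, sub_div, savg_const _ hN]
  · refine (havg.add_const (ε / 2)).congr' ?_
    filter_upwards [hS] with N hN
    rw [Finset.sum_add_distrib, add_div, savg_const _ hN]
  · rw [abs_le] at hint; linarith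
  · rw [abs_le] at hint; linarith

/-- **K–N Cor. 1.2 for an arbitrary averaging scheme**: the same for complex-valued `f` continuous on
`[0, 1]`, with the average written `|S_N|⁻¹ · Σ`. [cite: KuipersNiederreiter1974, Ch. 1, Corollary 1.2] -/
theorem tendsto_savg_complex_of_counting [DecidableEq X] (S : ℕ → Finset X) {v : X → ℝ}
    (hv : ∀ x, v x ∈ Set.Ico (0 : ℝ) 1) (hS : ∀ᶠ N in atTop, (S N).card ≠ 0)
    (hcount : ∀ a b : ℝ, 0 ≤ a → a < b → b ≤ 1 →
      Tendsto (fun N => (((S N).filter fun x => v x ∈ Set.Ico a b).card : ℝ) / (S N).card)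
        atTop (𝓝 (b - a)))
    {f : ℝ → ℂ} (hf : ContinuousOn f (Set.Icc 0 1)) :
    Tendsto (fun N => ((S N).card : ℂ)⁻¹ * ∑ x ∈ S N, f (v x)) atTop
      (𝓝 (∫ x in (0 : ℝ)..1, f x)) := by
  have hre := tendsto_savg_of_counting S hv hS hcount (Complex.continuous_re.comp_continuousOn hf)
  have him := tendsto_savg_of_counting S hv hS hcount (Complex.continuous_im.comp_continuousOn hf)
  have hfi : IntervalIntegrable f volume 0 1 := hf.intervalIntegrable_of_Icc zero_le_one
  have h1 : ∫ x in (0 : ℝ)..1, (f x).re = (∫ x in (0 : ℝ)..1, f x).re := by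
    simpa using intervalIntegral.intervalIntegral_re hfi
  have h2 : ∫ x in (0 : ℝ)..1, (f x).im = (∫ x in (0 : ℝ)..1, f x).im := by
    simpa using intervalIntegral.intervalIntegral_im hfi
  have hlim : Tendsto (fun N : ℕ => (((∑ x ∈ S N, (f (v x)).re) / (S N).card : ℝ) : ℂ) +
      (((∑ x ∈ S N, (f (v x)).im) / (S N).card : ℝ) : ℂ) * Complex.I) atTop
      (𝓝 (((∫ x in (0 : ℝ)..1, f x).re : ℂ) + ((∫ x in (0 : ℝ)..1, f x).im : ℂ) * Complex.I)) := by
    rw [← h1, ← h2]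
    exact ((Complex.continuous_ofReal.tendsto _).comp hre).add
      (((Complex.continuous_ofReal.tendsto _).comp him).mul_const Complex.I)
  rw [Complex.re_add_im] at hlim
  refine hlim.congr fun N => ?_
  rw [← div_eq_inv_mul]
  apply Complex.ext
  · simp [Complex.re_sum]
  · simp [Complex.im_sum]

end Scheme

/-! ### Polynomial sequences along Følner sequences of `ℤ` -/

/-- **Averages of continuous functions of `{p(n)}` along Følner sequences.** If `p ∈ ℝ[X]` has an
irrational coefficient of positive degree and `f : [0,1] → ℂ` is continuous, then
`|Φ_N|⁻¹ Σ_{n ∈ Φ_N} f({p(n)}) → ∫₀¹ f` for every Følner sequence `Φ` of `ℤ` (Weyl's Satz 12 in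
counting form, `weyl_tendsto_card_fract_mem_Ico`, and K–N Thm 1.1). [cite: Weyl1916, Satz 12] -/
theorem IsFoelnerSeq.tendsto_avg_comp_fract_poly {Φ : ℕ → Finset ℤ} (hΦ : IsFoelnerSeq Φ)
    (p : ℝ[X]) (hp : ∃ j, 1 ≤ j ∧ Irrational (p.coeff j)) {f : ℝ → ℂ}
    (hf : ContinuousOn f (Set.Icc 0 1)) :
    Tendsto (fun N => ((Φ N).card : ℂ)⁻¹ * ∑ n ∈ Φ N, f (Int.fract (p.eval (n : ℝ)))) atTop
      (𝓝 (∫ x in (0 : ℝ)..1, f x)) := by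
  refine tendsto_savg_complex_of_counting Φ (v := fun n : ℤ => Int.fract (p.eval (n : ℝ)))
    (fun n => ⟨Int.fract_nonneg _, Int.fract_lt_one _⟩) ?_ ?_ hf
  · filter_upwards [hΦ.eventually_nonempty] with N hN
    exact hN.card_pos.ne'
  · intro a b ha hab hb
    exact weyl_tendsto_card_fract_mem_Ico p hp hΦ ha hab hb

/-- **Rational coefficients give integral increments over a period**: if all coefficients of positive
degree of `p ∈ ℝ[X]` are rational, there is `q ≥ 1` with `p(n + q) - p(n) ∈ ℤ` for all `n ∈ ℤ`.
[folklore] -/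
theorem FoelnerWeyl.exists_period_of_rational_coeffs (p : ℝ[X])
    (hp : ∀ j, 1 ≤ j → ¬ Irrational (p.coeff j)) :
    ∃ q : ℕ, 0 < q ∧ ∀ n : ℤ, ∃ m : ℤ, p.eval ((n + q : ℤ) : ℝ) - p.eval (n : ℝ) = m := by
  classical
  -- rational witnesses for the coefficients of positive degree
  have hrat : ∀ j, ∃ ρ : ℚ, 1 ≤ j → (ρ : ℝ) = p.coeff j := by
    intro j
    by_cases hj : 1 ≤ j
    · have h := hp j hj
      unfold Irrational at h
      push Not at h
      obtain ⟨ρ, hρ⟩ := h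
      exact ⟨ρ, fun _ => hρ⟩
    · exact ⟨0, fun h => (hj h).elim⟩
  choose ρ hρ using hrat
  set D : ℕ := p.natDegree + 1 with hD
  set q : ℕ := ∏ j ∈ Finset.range D, (ρ j).den with hq
  have hqpos : 0 < q := Finset.prod_pos fun j _ => (ρ j).den_pos
  refine ⟨q, hqpos, fun n => ?_⟩
  -- `(n + q)^j - n^j = q · K j`
  have hdiv : ∀ j : ℕ, ∃ K : ℤ, (n + q) ^ j - n ^ j = q * K := fun j => by
    obtain ⟨K, hK⟩ : (q : ℤ) ∣ (n + q) ^ j - n ^ j := by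
      have := (Commute.all (n + q : ℤ) n).sub_dvd_pow_sub_pow j
      simpa using this
    exact ⟨K, hK⟩
  choose K hK using hdiv
  -- `den j ∣ q`
  have hden : ∀ j ∈ Finset.range D, ∃ e : ℕ, q = (ρ j).den * e := fun j hj =>
    Finset.dvd_prod_of_mem (fun j => (ρ j).den) hj
  choose! e he using hden
  refine ⟨∑ j ∈ Finset.range D, if 1 ≤ j then (ρ j).num * (e j) * K j else 0, ?_⟩
  rw [eval_eq_sum_range, eval_eq_sum_range, ← Finset.sum_sub_distrib]
  push_cast
  refine Finset.sum_congr rfl fun j hj => ?_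
  by_cases hj1 : 1 ≤ j
  · rw [if_pos hj1, ← mul_sub, ← hρ j hj1]
    have h1 : ((n : ℝ) + q) ^ j - (n : ℝ) ^ j = (q : ℝ) * (K j : ℝ) := by
      have := hK j
      exact_mod_cast this
    rw [h1, he j hj]
    have hden0 : ((ρ j).den : ℝ) ≠ 0 := by exact_mod_cast (ρ j).den_pos.ne'
    rw [Rat.cast_def]
    push_cast
    field_simp
  · rw [if_neg hj1]
    have hj0 : j = 0 := by omega
    subst hj0
    simp

/-- **The bracket `c{p(n)} + d` case of Bergelson–Leibman's Cor. 0.26, unconditionally.** For all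
real `c, d` and `p ∈ ℝ[X]` there is `C ∈ ℂ` with `|Φ_N|⁻¹ Σ_{n ∈ Φ_N} e(c{p(n)} + d) → C` along
EVERY Følner sequence `Φ` of `ℤ`: if some coefficient of positive degree is irrational,
`C = ∫₀¹ e(cx + d) dx` (Weyl + K–N Thm 1.1); otherwise `{p(n)}` is periodic and `C` is the mean
over a period. This is the inner statement of `BergelsonLeibman2007_cor_0_26` for the generalized
polynomial `u = c·{p} + d` (`isGeneralizedPolynomial_const_mul_fract_poly_add`).
[cite: BergelsonLeibman2007, Cor. 0.26 (case)] -/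
theorem bergelsonLeibman2007_cor_0_26_const_mul_fract_poly (c d : ℝ) (p : ℝ[X]) :
    ∃ C : ℂ, ∀ Φ : ℕ → Finset ℤ, IsFoelnerSeq Φ →
      Tendsto (fun N => ((Φ N).card : ℂ)⁻¹ *
        ∑ n ∈ Φ N, Complex.exp (2 * Real.pi * Complex.I *
          ((fun n : ℤ => c * Int.fract (p.eval (n : ℝ)) + d) n : ℂ))) atTop (nhds C) := by
  by_cases hirr : ∃ j, 1 ≤ j ∧ Irrational (p.coeff j)
  · set f : ℝ → ℂ := fun x => Complex.exp (2 * Real.pi * Complex.I * ((c * x + d : ℝ) : ℂ))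
      with hf_def
    have hfc : Continuous f := by
      rw [hf_def]
      fun_prop
    refine ⟨∫ x in (0 : ℝ)..1, f x, fun Φ hΦ => ?_⟩
    have key : ∀ n : ℤ, Complex.exp (2 * Real.pi * Complex.I *
        ((fun n : ℤ => c * Int.fract (p.eval (n : ℝ)) + d) n : ℂ)) =
          f (Int.fract (p.eval (n : ℝ))) := fun n => rfl
    simp_rw [key]
    exact hΦ.tendsto_avg_comp_fract_poly p hirr hfc.continuousOn
  · push Not at hirr
    have hp : ∀ j, 1 ≤ j → ¬ Irrational (p.coeff j) := fun j hj h => hirr j hj h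
    obtain ⟨q, hq, hper⟩ := FoelnerWeyl.exists_period_of_rational_coeffs p hp
    set F : ℤ → ℂ := fun n => Complex.exp (2 * Real.pi * Complex.I *
      ((c * Int.fract (p.eval (n : ℝ)) + d : ℝ) : ℂ)) with hF
    have hFper : Function.Periodic F (q : ℤ) := by
      intro n
      obtain ⟨m, hm⟩ := hper n
      simp only [hF]
      rw [show p.eval ((n + q : ℤ) : ℝ) = p.eval (n : ℝ) + m by linarith, Int.fract_add_intCast]
    refine ⟨(q : ℂ)⁻¹ * ∑ r ∈ Finset.range q, F r, fun Φ hΦ => ?_⟩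
    exact hΦ.tendsto_avg_of_periodic hq hFper

/-- `u(n) = c·{p(n)} + d` is a generalized polynomial (so the previous theorem is an unconditional
instance of the fact `BergelsonLeibman2007_cor_0_26`). [cite: BergelsonLeibman2007, §0.1] -/
theorem isGeneralizedPolynomial_const_mul_fract_poly_add (c d : ℝ) (p : ℝ[X]) :
    IsGeneralizedPolynomial fun n : ℤ => c * Int.fract (p.eval (n : ℝ)) + d := by
  have h := ((IsGeneralizedPolynomial.const c).mul (IsGeneralizedPolynomial.poly p).fract).add
    (IsGeneralizedPolynomial.const d)
  convert h using 1
  funext n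
  simp only [Pi.add_apply, Pi.mul_apply]

/-! ### Consumer API of the fact -/

/-- Generalized polynomials are closed under real scalar multiples. [cite: BergelsonLeibman2007, §0.3] -/
theorem IsGeneralizedPolynomial.const_mul (c : ℝ) {u : ℤ → ℝ} (hu : IsGeneralizedPolynomial u) :
    IsGeneralizedPolynomial fun n => c * u n := by
  have h := (IsGeneralizedPolynomial.const c).mul hu
  convert h using 1
  funext n
  simp only [Pi.mul_apply]

/-- **How the fact is consumed**: `BergelsonLeibman2007_cor_0_26` gives, for every generalized
polynomial `u` and every real frequency `h`, the existence of the limit of the standard averages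
`N⁻¹ Σ_{n<N} e(h u(n))` (the Følner sequence `{0, …, N-1}`).
[cite: BergelsonLeibman2007, Cor. 0.26] -/
theorem BergelsonLeibman2007_cor_0_26.exists_tendsto_avg_range (hBL : BergelsonLeibman2007_cor_0_26)
    {u : ℤ → ℝ} (hu : IsGeneralizedPolynomial u) (h : ℝ) :
    ∃ c : ℂ, Tendsto (fun N : ℕ => (N : ℂ)⁻¹ *
      ∑ n ∈ Finset.range N, Complex.exp (2 * Real.pi * Complex.I * ((h * u n : ℝ) : ℂ)))
      atTop (𝓝 c) := by
  obtain ⟨c, hc⟩ := hBL _ (hu.const_mul h)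
  refine ⟨c, (hc _ isFoelnerSeq_Ico).congr fun N => ?_⟩
  rw [← FoelnerWeyl.map_natCast_range, Finset.sum_map, Finset.card_map, Finset.card_range]
  rfl

end Literature.NumberTheory.DiophantineApproximation

end
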